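import Summits.Ventures.PercRepro.TheoremNAll

/-!
# PercRepro — C-025 under rank deficiency: the cogirth criterion (p9, gen 16)

THE THEOREM (`rls_of_rankDeficient`): for a finite matroid `M` and `q + 2 ≤ p`, if every `A ⊆ E` of rank
`u < p` has at least `p + q − u` elements `e ∈ E` with `ρ(A ∪ e) = ρ(A) + 1` (**rank deficiency** at `(p, q)`),
then `ThmN.RLS M p q` — the body of `C025` at `(p, q)`. Rank deficiency holds whenever every cocircuit has at
least `q + 1` elements (`rankDeficient_of_hyperplanes`: the complements `E ∖ cl(A)` of the rank-`(r − 1)` sets are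
the cocircuits), so **C-025 at `(p, q)` holds on every finite matroid of cogirth `≥ q + 1`**, every `p ≥ q + 2`
(`rls_of_cogirth`); and it holds on `T_p(B ⊕ U_{m,m})` whenever `ρ(B) + m ≥ p + q` (`CogirthBlockFree.lean`).

THE PROOF is one double count on the rank distribution `c_u = #{A ⊆ E : ρ(A) = u}`:
* `(p + q − u)·c_u ≤ (u + 1)·c_{u+1}` for `u < p` (`levelCount_step`): the pairs `(A, e)` with `ρ(A) = u` and
  `ρ(A ∪ e) = u + 1` number at least `p + q − u` per `A` (rank deficiency) and inject into the pairs `(A', e)`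
  with `ρ(A') = u + 1`, `e ∈ A'`, `ρ(A' ∖ e) = u`, of which there are at most `u + 1` per `A'` — those `e` form an
  independent subset of `A'` (`e ∉ cl(A' ∖ e)`);
* hence `c_q·C(p+q, u) ≤ c_u·C(p+q, q)` for `q ≤ u ≤ p` (`levelCount_mul_choose`, Pascal's ratio
  `C(n, u+1)·(u+1) = C(n, u)·(n − u)`);
* `#U(p, q) ≤ c_q` (`A ↦ E ∖ A`) and `#Y(p, q) = Σ_{q<u<p} c_u`, so `Φ(p, q)·#U ≤ c_q·Σ_u C(p+q, u)/C(p+q, q)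
  ≤ Σ_u c_u = #Y`.
Nothing here is a statement about any window of the crux: the criterion is a hypothesis on the matroid.
-/

namespace PercRepro.RankDist

open Set Finset Matroid

variable {α : Type}

/-- The rank of `A` as a natural number. -/
noncomputable def rk (M : Matroid α) (A : Set α) : ℕ := (M.eRk A).toNat

/-- The subsets of the ground set, as a finset. -/
noncomputable def subsetsFin (M : Matroid α) [M.Finite] : Finset (Set α) :=
  M.ground_finite.finite_subsets.toFinset

/-- `c_u`: the number of subsets of `E` of rank `u` (the rank distribution). -/
noncomputable def levelCount (M : Matroid α) [M.Finite] (u : ℕ) : ℕ :=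
  ((subsetsFin M).filter (fun A => rk M A = u)).card

/-- The elements of `E` that increase the rank of `A`: `ρ(A ∪ e) = ρ(A) + 1`. -/
noncomputable def extSet (M : Matroid α) [M.Finite] (A : Set α) : Finset α :=
  M.ground_finite.toFinset.filter (fun e => M.eRk (insert e A) = M.eRk A + 1)

/-- **Rank deficiency at `(p, q)`**: every `A ⊆ E` of rank `< p` has at least `p + q − ρ(A)` rank-increasing
elements. -/
def RankDeficient (M : Matroid α) [M.Finite] (p q : ℕ) : Prop :=
  ∀ A ⊆ M.E, M.eRk A < p → p + q ≤ rk M A + (extSet M A).card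

/-- Membership in `subsetsFin`. -/
lemma mem_subsetsFin (M : Matroid α) [M.Finite] {A : Set α} : A ∈ subsetsFin M ↔ A ⊆ M.E := by
  rw [subsetsFin, Set.Finite.mem_toFinset, mem_setOf_eq]

/-- On a finite matroid the rank of a subset of `E` is the cast of its natural rank. -/
lemma eRk_eq_coe_rk (M : Matroid α) [M.Finite] {A : Set α} (hA : A ⊆ M.E) : M.eRk A = (rk M A : ℕ∞) :=
  (ENat.coe_toNat (M.isRkFinite_of_finite (M.ground_finite.subset hA)).eRk_lt_top.ne).symm

/-- `rk M A = u` iff `M.eRk A = u` (for `A ⊆ E`). -/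
lemma rk_eq_iff (M : Matroid α) [M.Finite] {A : Set α} (hA : A ⊆ M.E) (u : ℕ) :
    rk M A = u ↔ M.eRk A = (u : ℕ∞) := by
  rw [eRk_eq_coe_rk M hA, Nat.cast_inj]

/-- Membership in `extSet`. -/
lemma mem_extSet (M : Matroid α) [M.Finite] {A : Set α} {e : α} :
    e ∈ extSet M A ↔ e ∈ M.E ∧ M.eRk (insert e A) = M.eRk A + 1 := by
  rw [extSet, mem_filter, Set.Finite.mem_toFinset]

/-- A rank-increasing element is outside `A`. -/
lemma notMem_of_mem_extSet (M : Matroid α) [M.Finite] {A : Set α} (hA : A ⊆ M.E) {e : α}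
    (he : e ∈ extSet M A) : e ∉ A := by
  intro heA
  rw [mem_extSet, Set.insert_eq_of_mem heA, eRk_eq_coe_rk M hA] at he
  have := he.2
  exact absurd this (by
    intro h
    have h' : ((rk M A : ℕ) : ℕ∞) = ((rk M A + 1 : ℕ) : ℕ∞) := by rw [Nat.cast_add, Nat.cast_one]; exact h
    rw [Nat.cast_inj] at h'
    omega)

/-- The elements `e ∈ A` (in `E`) whose removal drops the rank of `A` to `u`. -/
noncomputable def dropSet (M : Matroid α) [M.Finite] (A : Set α) (u : ℕ) : Finset α :=
  (M.ground_finite.inter_of_left {e | e ∈ A ∧ rk M (A \ {e}) = u}).toFinset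

/-- Membership in `dropSet`. -/
lemma mem_dropSet (M : Matroid α) [M.Finite] {A : Set α} {u : ℕ} {e : α} :
    e ∈ dropSet M A u ↔ e ∈ M.E ∧ e ∈ A ∧ rk M (A \ {e}) = u := by
  rw [dropSet, Set.Finite.mem_toFinset, Set.mem_inter_iff, mem_setOf_eq]

/-- The elements `e ∈ A` with `ρ(A ∖ e) < ρ(A)` form an independent set; hence at most `ρ(A)` of them. -/
lemma card_dropSet_le (M : Matroid α) [M.Finite] {A : Set α} (hA : A ⊆ M.E) (u : ℕ) (hu : rk M A = u + 1) :
    (dropSet M A u).card ≤ u + 1 := by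
  set D := dropSet M A u with hD
  have hDA : (D : Set α) ⊆ A := by
    intro e he
    rw [Finset.mem_coe, hD, mem_dropSet] at he
    exact he.2.1
  have hDE : (D : Set α) ⊆ M.E := hDA.trans hA
  have hind : M.Indep (D : Set α) := by
    rw [Matroid.indep_iff_forall_notMem_closure_sdiff hDE]
    intro e he hcl
    rw [Finset.mem_coe, hD, mem_dropSet] at he
    have hsub : (D : Set α) \ {e} ⊆ A \ {e} := Set.sdiff_subset_sdiff_left hDA
    have hcl' : e ∈ M.closure (A \ {e}) := M.closure_subset_closure hsub hcl
    have h1 : M.closure (insert e (A \ {e})) = M.closure (A \ {e}) :=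
      Matroid.closure_insert_eq_of_mem_closure hcl'
    rw [Set.insert_sdiff_singleton, Set.insert_eq_of_mem he.2.1] at h1
    have h2 : M.eRk A = M.eRk (A \ {e}) := by
      rw [← M.eRk_closure_eq A, h1, M.eRk_closure_eq]
    rw [eRk_eq_coe_rk M hA, eRk_eq_coe_rk M (Set.sdiff_subset.trans hA), Nat.cast_inj] at h2
    omega
  have hle := hind.encard_le_eRk_of_subset hDA
  rw [Set.encard_coe_eq_coe_finsetCard, eRk_eq_coe_rk M hA, hu, Nat.cast_le] at hle
  exact hle

/-- **THE DOUBLE COUNT**: under rank deficiency at `(p, q)`, `(p + q − u)·c_u ≤ (u + 1)·c_{u+1}` for `u < p`. -/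
theorem levelCount_step (M : Matroid α) [M.Finite] (p q u : ℕ) (hu : u < p) (hdef : RankDeficient M p q) :
    (p + q - u) * levelCount M u ≤ (u + 1) * levelCount M (u + 1) := by
  classical
  set s : Finset (Σ _ : Set α, α) :=
    ((subsetsFin M).filter (fun A => rk M A = u)).sigma (fun A => extSet M A) with hs
  set t : Finset (Σ _ : Set α, α) :=
    ((subsetsFin M).filter (fun A => rk M A = u + 1)).sigma (fun A => dropSet M A u) with ht
  have h1 : (p + q - u) * levelCount M u ≤ s.card := by
    rw [hs, card_sigma, levelCount, mul_comm, ← smul_eq_mul, ← Finset.sum_const]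
    refine Finset.sum_le_sum fun A hA => ?_
    rw [mem_filter, mem_subsetsFin] at hA
    have hlt : M.eRk A < p := by
      rw [eRk_eq_coe_rk M hA.1, hA.2, Nat.cast_lt]; exact hu
    have := hdef A hA.1 hlt
    omega
  have h2 : t.card ≤ (u + 1) * levelCount M (u + 1) := by
    rw [ht, card_sigma, levelCount, mul_comm, ← smul_eq_mul, ← Finset.sum_const]
    refine Finset.sum_le_sum fun A hA => ?_
    rw [mem_filter, mem_subsetsFin] at hA
    exact card_dropSet_le M hA.1 u hA.2
  have h3 : s.card ≤ t.card := by
    refine Finset.card_le_card_of_injOn (fun x => ⟨insert x.2 x.1, x.2⟩) ?_ ?_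
    · intro x hx
      rw [Finset.mem_coe, hs, Finset.mem_sigma, mem_filter, mem_subsetsFin] at hx
      obtain ⟨⟨hxE, hxu⟩, hxe⟩ := hx
      have hnot : x.2 ∉ x.1 := notMem_of_mem_extSet M hxE hxe
      rw [mem_extSet] at hxe
      rw [Finset.mem_coe, ht, Finset.mem_sigma, mem_filter, mem_subsetsFin, mem_dropSet]
      refine ⟨⟨Set.insert_subset hxe.1 hxE, ?_⟩, hxe.1, Set.mem_insert _ _, ?_⟩
      · rw [rk_eq_iff M (Set.insert_subset hxe.1 hxE), hxe.2, eRk_eq_coe_rk M hxE, hxu]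
        push_cast; rfl
      · rw [Set.insert_sdiff_self_of_notMem hnot]; exact hxu
    · intro x hx y hy hxy
      rw [Finset.mem_coe, hs, Finset.mem_sigma, mem_filter, mem_subsetsFin] at hx hy
      have hnx : x.2 ∉ x.1 := notMem_of_mem_extSet M hx.1.1 hx.2
      have hny : y.2 ∉ y.1 := notMem_of_mem_extSet M hy.1.1 hy.2
      simp only [Sigma.mk.inj_iff, heq_iff_eq] at hxy
      obtain ⟨hAB, hee⟩ := hxy
      rw [← hee] at hAB
      have hAB' : x.1 = y.1 := by
        rw [← Set.insert_sdiff_self_of_notMem hnx, hAB, Set.insert_sdiff_self_of_notMem (hee ▸ hny)]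
      exact Sigma.ext hAB' (heq_of_eq hee)
  omega

/-- Pascal's ratio transported along the rank distribution: `c_q·C(p+q, u) ≤ c_u·C(p+q, q)` for `q ≤ u ≤ p`. -/
theorem levelCount_mul_choose (M : Matroid α) [M.Finite] (p q : ℕ) (hdef : RankDeficient M p q) :
    ∀ u, q ≤ u → u ≤ p → levelCount M q * (p + q).choose u ≤ levelCount M u * (p + q).choose q := by
  intro u hqu
  induction u, hqu using Nat.le_induction with
  | base => intro _; exact le_refl _
  | succ u hqu ih =>
    intro hup
    have ih' := ih (by omega)
    have hstep := levelCount_step M p q u (by omega) hdef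
    have hpas := Nat.choose_succ_right_eq (p + q) u
    have hsub : p + q - u = p + q - u := rfl
    -- multiply both sides by (u + 1) and cancel
    have key : levelCount M q * (p + q).choose (u + 1) * (u + 1)
        ≤ levelCount M (u + 1) * (p + q).choose q * (u + 1) := by
      calc levelCount M q * (p + q).choose (u + 1) * (u + 1)
          = levelCount M q * ((p + q).choose u * (p + q - u)) := by rw [mul_assoc, hpas]
        _ = (levelCount M q * (p + q).choose u) * (p + q - u) := by ring
        _ ≤ (levelCount M u * (p + q).choose q) * (p + q - u) := Nat.mul_le_mul_right _ ih'
        _ = ((p + q - u) * levelCount M u) * (p + q).choose q := by ring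
        _ ≤ ((u + 1) * levelCount M (u + 1)) * (p + q).choose q := Nat.mul_le_mul_right _ hstep
        _ = levelCount M (u + 1) * (p + q).choose q * (u + 1) := by ring
    exact Nat.le_of_mul_le_mul_right key (by omega)

/-- `#U(p, q) ≤ c_q`: the complement map `A ↦ E ∖ A` injects `U` into the rank-`q` sets. -/
theorem ncard_U_le_levelCount (M : Matroid α) [M.Finite] (p q : ℕ) :
    {A : Set α | A ⊆ M.E ∧ M.eRk A = (p : ℕ∞) ∧ M.eRk (M.E \ A) = (q : ℕ∞)}.ncard ≤ levelCount M q := by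
  classical
  rw [levelCount, ← Set.ncard_coe_finset]
  refine Set.ncard_le_ncard_of_injOn (fun A => M.E \ A) ?_ ?_ (Finset.finite_toSet _)
  · intro A hA
    rw [mem_setOf_eq] at hA
    rw [Finset.mem_coe, mem_filter, mem_subsetsFin]
    exact ⟨Set.sdiff_subset, (rk_eq_iff M Set.sdiff_subset q).2 hA.2.2⟩
  · intro A hA B hB hAB
    rw [mem_setOf_eq] at hA hB
    simp only at hAB
    rw [← Set.sdiff_sdiff_cancel_left hA.1, hAB, Set.sdiff_sdiff_cancel_left hB.1]

/-- `#Y(p, q) = Σ_{q<u<p} c_u`: the middle band is the disjoint union of the rank levels. -/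
theorem ncard_Y_eq_sum (M : Matroid α) [M.Finite] (p q : ℕ) :
    {A : Set α | A ⊆ M.E ∧ (q : ℕ∞) < M.eRk A ∧ M.eRk A < (p : ℕ∞)}.ncard = ∑ u ∈ Ioo q p, levelCount M u := by
  classical
  have hset : {A : Set α | A ⊆ M.E ∧ (q : ℕ∞) < M.eRk A ∧ M.eRk A < (p : ℕ∞)}
      = ↑((subsetsFin M).filter (fun A => q < rk M A ∧ rk M A < p)) := by
    ext A
    rw [mem_setOf_eq, Finset.mem_coe, mem_filter, mem_subsetsFin]
    constructor
    · rintro ⟨hA, h1, h2⟩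
      rw [eRk_eq_coe_rk M hA, Nat.cast_lt] at h1 h2
      exact ⟨hA, h1, h2⟩
    · rintro ⟨hA, h1, h2⟩
      rw [eRk_eq_coe_rk M hA, Nat.cast_lt, Nat.cast_lt]
      exact ⟨hA, h1, h2⟩
  rw [hset, Set.ncard_coe_finset]
  rw [Finset.card_eq_sum_card_fiberwise (f := rk M) (t := Ioo q p)]
  · refine Finset.sum_congr rfl fun u hu => ?_
    rw [levelCount, Finset.filter_filter]
    refine congrArg Finset.card (Finset.filter_congr fun A _ => ?_)
    rw [Finset.mem_Ioo] at hu
    constructor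
    · exact fun h => h.2
    · intro h; exact ⟨⟨by omega, by omega⟩, h⟩
  · intro A hA
    rw [Finset.mem_coe, mem_filter] at hA
    rw [Finset.mem_coe, Finset.mem_Ioo]
    exact hA.2

/-- **C-025 UNDER RANK DEFICIENCY**: for every finite matroid `M` and every `(p, q)`, rank deficiency at `(p, q)`
implies `ThmN.RLS M p q` (the crux's pairs are `q + 2 ≤ p`; for `p ≤ q + 1` the band `q < ρ < p` is empty and
`Φ(p, q) = 0`). -/
theorem rls_of_rankDeficient (M : Matroid α) [M.Finite] (p q : ℕ) (hdef : RankDeficient M p q) :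
    ThmN.RLS M p q := by
  unfold ThmN.RLS phiK
  have hU := ncard_U_le_levelCount M p q
  rw [ncard_Y_eq_sum M p q]
  have hpos : (0 : ℚ) < ((p + q).choose p : ℚ) := by
    exact_mod_cast Nat.choose_pos (by omega)
  rw [div_mul_eq_mul_div, div_le_iff₀ hpos]
  have key : (∑ u ∈ Ioo q p, (p + q).choose u)
      * {A : Set α | A ⊆ M.E ∧ M.eRk A = (p : ℕ∞) ∧ M.eRk (M.E \ A) = (q : ℕ∞)}.ncard
      ≤ (∑ u ∈ Ioo q p, levelCount M u) * (p + q).choose p := by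
    calc (∑ u ∈ Ioo q p, (p + q).choose u)
          * {A : Set α | A ⊆ M.E ∧ M.eRk A = (p : ℕ∞) ∧ M.eRk (M.E \ A) = (q : ℕ∞)}.ncard
        ≤ (∑ u ∈ Ioo q p, (p + q).choose u) * levelCount M q := Nat.mul_le_mul_left _ hU
      _ = ∑ u ∈ Ioo q p, levelCount M q * (p + q).choose u := by
          rw [Finset.sum_mul]; exact Finset.sum_congr rfl fun u _ => mul_comm _ _
      _ ≤ ∑ u ∈ Ioo q p, levelCount M u * (p + q).choose q := by
          refine Finset.sum_le_sum fun u hu => ?_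
          rw [Finset.mem_Ioo] at hu
          exact levelCount_mul_choose M p q hdef u (by omega) (by omega)
      _ = (∑ u ∈ Ioo q p, levelCount M u) * (p + q).choose p := by
          rw [Finset.sum_mul, Nat.choose_symm_add]
  exact_mod_cast key

/-! ### Rank deficiency from the closure form and from the cocircuits -/

/-- The closure form: `p + q ≤ ρ(A) + |E ∖ cl(A)|` for every `A ⊆ E` of rank `< p` gives rank deficiency
(every `e ∈ E ∖ cl(A)` increases the rank). -/
theorem rankDeficient_of_closure (M : Matroid α) [M.Finite] (p q : ℕ)
    (h : ∀ A ⊆ M.E, M.eRk A < p → p + q ≤ rk M A + (M.E \ M.closure A).ncard) : RankDeficient M p q := by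
  classical
  intro A hA hlt
  refine (h A hA hlt).trans (Nat.add_le_add_left ?_ _)
  have hsub : (M.E \ M.closure A) ⊆ ↑(extSet M A) := by
    intro e he
    rw [Finset.mem_coe, mem_extSet]
    exact ⟨he.1, Matroid.eRk_insert_eq_add_one he⟩
  have := Set.ncard_le_ncard hsub (Finset.finite_toSet _)
  rwa [Set.ncard_coe_finset] at this

/-- Every set of rank `< r = ρ(E)` has an element of `E` outside its closure. -/
lemma exists_notMem_closure (M : Matroid α) [M.Finite] {A : Set α} (hA : M.eRk A < M.eRank) :
    ∃ e ∈ M.E, e ∉ M.closure A := by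
  by_contra h
  have hsub : M.E ⊆ M.closure A := fun e he => by_contra fun hne => h ⟨e, he, hne⟩
  have := M.eRk_mono hsub
  rw [M.eRk_closure_eq, Matroid.eRk_eq_eRank (subset_refl _)] at this
  exact absurd hA (not_lt.2 this)

/-- The chain from a set of rank `r − 1 − k` to the cocircuits: if every set of rank `r − 1` misses at least
`q + 1` elements of `E` in its closure, a set of rank `r − 1 − k` misses at least `q + 1 + k`. -/
theorem ncard_compl_closure_of_hyperplanes (M : Matroid α) [M.Finite] (r q : ℕ) (hr : M.eRank = (r : ℕ∞))
    (hhyp : ∀ A ⊆ M.E, M.eRk A + 1 = (r : ℕ∞) → q + 1 ≤ (M.E \ M.closure A).ncard) :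
    ∀ k : ℕ, ∀ A ⊆ M.E, M.eRk A + 1 + (k : ℕ∞) = (r : ℕ∞) → q + 1 + k ≤ (M.E \ M.closure A).ncard := by
  intro k
  induction k with
  | zero =>
    intro A hA h
    rw [Nat.cast_zero, add_zero] at h
    exact hhyp A hA h
  | succ k ih =>
    intro A hA h
    have hlt : M.eRk A < M.eRank := by
      rw [hr, ← h, eRk_eq_coe_rk M hA]
      norm_cast
      omega
    obtain ⟨e, heE, hecl⟩ := exists_notMem_closure M hlt
    have hA' : insert e A ⊆ M.E := Set.insert_subset heE hA
    have hrk : M.eRk (insert e A) = M.eRk A + 1 := Matroid.eRk_insert_eq_add_one ⟨heE, hecl⟩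
    have h' : M.eRk (insert e A) + 1 + (k : ℕ∞) = (r : ℕ∞) := by
      rw [hrk, ← h]; push_cast; ring
    have ih' := ih (insert e A) hA' h'
    have hsub : M.E \ M.closure (insert e A) ⊆ M.E \ M.closure A :=
      Set.sdiff_subset_sdiff_right (M.closure_subset_closure (Set.subset_insert _ _))
    have hecl' : e ∈ M.closure (insert e A) := M.mem_closure_of_mem' (Set.mem_insert _ _) heE
    have hnot : e ∉ M.E \ M.closure (insert e A) := fun h => h.2 hecl'
    have hins : insert e (M.E \ M.closure (insert e A)) ⊆ M.E \ M.closure A :=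
      Set.insert_subset ⟨heE, hecl⟩ hsub
    have hfin : (M.E \ M.closure A).Finite := M.ground_finite.subset Set.sdiff_subset
    have := Set.ncard_le_ncard hins hfin
    rw [Set.ncard_insert_of_notMem hnot (hfin.subset hsub)] at this
    omega

/-- **Cogirth `≥ q + 1` gives rank deficiency** at every `(p, q)` with `p ≤ ρ(E)`: if every set `A` of rank
`ρ(E) − 1` has at least `q + 1` elements of `E` outside its closure (the complement `E ∖ cl(A)` is a
cocircuit, and every cocircuit arises this way), then `M` is rank deficient at `(p, q)`. -/
theorem rankDeficient_of_hyperplanes (M : Matroid α) [M.Finite] (p q r : ℕ) (hr : M.eRank = (r : ℕ∞))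
    (hp : p ≤ r) (hhyp : ∀ A ⊆ M.E, M.eRk A + 1 = (r : ℕ∞) → q + 1 ≤ (M.E \ M.closure A).ncard) :
    RankDeficient M p q := by
  refine rankDeficient_of_closure M p q fun A hA hlt => ?_
  rw [eRk_eq_coe_rk M hA, Nat.cast_lt] at hlt
  have hchain := ncard_compl_closure_of_hyperplanes M r q hr hhyp (r - 1 - rk M A) A hA (by
    rw [eRk_eq_coe_rk M hA]
    have : rk M A + 1 + (r - 1 - rk M A) = r := by omega
    exact_mod_cast this)
  omega

/-- **C-025 ON EVERY MATROID OF COGIRTH `≥ q + 1`**: for `p ≤ ρ(E)` (the crux's pairs are `q + 2 ≤ p`), if every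
set of rank `ρ(E) − 1` misses at least `q + 1` elements of `E` in its closure (every cocircuit has `≥ q + 1`
elements), then `ThmN.RLS M p q`. (For `p > ρ(E)` the statement is `ThmN.RLS_of_eRank_lt`.) -/
theorem rls_of_cogirth (M : Matroid α) [M.Finite] (p q r : ℕ) (hr : M.eRank = (r : ℕ∞)) (hp : p ≤ r)
    (hhyp : ∀ A ⊆ M.E, M.eRk A + 1 = (r : ℕ∞) → q + 1 ≤ (M.E \ M.closure A).ncard) : ThmN.RLS M p q :=
  rls_of_rankDeficient M p q (rankDeficient_of_hyperplanes M p q r hr hp hhyp)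

end PercRepro.RankDist
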